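import Mathlib
import HarnessLib
import Summits.ValiantsHypothesis.ValiantsHypothesis.Theorems.LacunarySymmetroidMatrixDescartesProductPlusOneSeparatingWeightFloorMixed

/-!
# ValiantsHypothesis / LacunarySymmetroid — crux `MatrixDescartes` (stmt-ValiantsHypothesis-18050, V1),
# LINE (A) «product_plus_one»: `OneChangeFloorK3` ON THE RATIO-ORDERED SECTOR — the floor's own quantifier shape, constant `C = 2`

Registry form of ✓ `sepWeight_ratioOrdered_mixed_floor`.  The floor (skeleton `Cruxes/MatrixDescartes/Lines/product_plus_one.lean`) reads
`OneChangeFloorK3 : ∃ C, ∀ m d a, d 0 < d 1 → d 1 < d 2 → (∀ j, ¬(a j 0·a j 1 < 0 ∧ a j 1·a j 2 < 0)) → Z₊(eulerNumerator d a 0) ≤ C·m + C`.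
Below, the SAME quantifier shape with the one-change hypothesis SPECIALISED to the two row types of the floor's open core — incoherent
no-dip `(+,−,−)` and one-signed `(+,+,+)` — plus ONE extra hypothesis, the pointwise RATIO ORDER (every one-signed row and every switched
incoherent row at least as middle-heavy as every unswitched incoherent row), is PROVED with `C = 2`, uniformly in the support (no ratio
window) and in the company (any number of rows of either type):

* ★★★ `oneChangeFloorK3_on_ratioOrderedSector`.

What separates this from the floor itself is exactly the order hypothesis; the floor's remaining content is a budget for the zeros at which a
switched row is MORE top-heavy than an unswitched one (✓ `…SeparatingWeight` docstring, item NOTE §3–§5).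
HONEST FRAMING: a sector of the research floor; NOT `OneChangeFloorK3`, not `MatrixDescartes`; `VP ≠ VNP` is NOT proved.  No definitions,
no named facts, no sorry.
-/

set_option linter.dupNamespace false

namespace Summit.ValiantsHypothesis.ValiantsHypothesis.Theorems.LacunarySymmetroidMatrixDescartes

namespace ProductPlusOne

open Polynomial Finset
open scoped BigOperators

/-- ★★★ **`OneChangeFloorK3` on the ratio-ordered sector, `C = 2`** (the floor's quantifier shape; rows incoherent no-dip or one-signed;
pointwise ratio order `a_{i1}/a_{i2} ≤ a_{j1}/a_{j2}` for `j` one-signed or switched incoherent and `i` unswitched incoherent). [this file's theorem] -/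
theorem oneChangeFloorK3_on_ratioOrderedSector :
    ∃ C₀ : ℕ, ∀ (m : ℕ) (d : Fin 3 → ℕ) (a : Fin m → Fin 3 → ℝ), d 0 < d 1 → d 1 < d 2 →
      (∀ j, (0 < a j 0 ∧ a j 1 < 0 ∧ a j 2 < 0) ∨ (0 < a j 0 ∧ 0 < a j 1 ∧ 0 < a j 2)) →
      (∀ x : ℝ, 0 < x → ∀ j i,
        ((0 < a j 1 ∧ 0 < a j 2) ∨ a j 0 * x ^ (d 0) + a j 1 * x ^ (d 1) + a j 2 * x ^ (d 2) < 0) →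
        (a i 1 < 0 ∧ a i 2 < 0) → 0 < a i 0 * x ^ (d 0) + a i 1 * x ^ (d 1) + a i 2 * x ^ (d 2) →
        a i 1 / a i 2 ≤ a j 1 / a j 2) →
      ((∑ j, (∑ l, C (a j l * ((d l : ℝ) - d 0)) * X ^ (d l)) * ∏ i ∈ Finset.univ.erase j, (∑ l, C (a i l) * X ^ (d l))
          : ℝ[X]).roots.toFinset.filter (fun t => 0 < t)).card ≤ C₀ * m + C₀ := by
  refine ⟨2, fun m d a h01 h12 hrows hord => ?_⟩
  have h := sepWeight_ratioOrdered_mixed_floor d h01 h12 a hrows hord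
  omega

/-- The same with the floor's literal one-change hypothesis carried along (it is implied by the sector's row types, so it is idle here;
displayed only to make the comparison with `OneChangeFloorK3` syntactic). [this file's theorem] -/
theorem oneChangeFloorK3_on_ratioOrderedSector' :
    ∃ C₀ : ℕ, ∀ (m : ℕ) (d : Fin 3 → ℕ) (a : Fin m → Fin 3 → ℝ), d 0 < d 1 → d 1 < d 2 →
      (∀ j, ¬ (a j 0 * a j 1 < 0 ∧ a j 1 * a j 2 < 0)) →
      (∀ j, (0 < a j 0 ∧ a j 1 < 0 ∧ a j 2 < 0) ∨ (0 < a j 0 ∧ 0 < a j 1 ∧ 0 < a j 2)) →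
      (∀ x : ℝ, 0 < x → ∀ j i,
        ((0 < a j 1 ∧ 0 < a j 2) ∨ a j 0 * x ^ (d 0) + a j 1 * x ^ (d 1) + a j 2 * x ^ (d 2) < 0) →
        (a i 1 < 0 ∧ a i 2 < 0) → 0 < a i 0 * x ^ (d 0) + a i 1 * x ^ (d 1) + a i 2 * x ^ (d 2) →
        a i 1 / a i 2 ≤ a j 1 / a j 2) →
      ((∑ j, (∑ l, C (a j l * ((d l : ℝ) - d 0)) * X ^ (d l)) * ∏ i ∈ Finset.univ.erase j, (∑ l, C (a i l) * X ^ (d l))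
          : ℝ[X]).roots.toFinset.filter (fun t => 0 < t)).card ≤ C₀ * m + C₀ := by
  obtain ⟨C₀, hC⟩ := oneChangeFloorK3_on_ratioOrderedSector
  exact ⟨C₀, fun m d a h01 h12 _ hrows hord => hC m d a h01 h12 hrows hord⟩

end ProductPlusOne

end Summit.ValiantsHypothesis.ValiantsHypothesis.Theorems.LacunarySymmetroidMatrixDescartes
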